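import Summits.QuantumFields.YangMills.Theorems.LuscherReductionTwistedTraceScalingAlmostCommutingSU2
import Summits.QuantumFields.YangMills.Theorems.LuscherReductionTwistedTraceScalingCurvatureAction
import Summits.QuantumFields.YangMills.Theorems.LuscherReductionRunningReductionTreeGauge
import HarnessLib

/-!
# APPROXIMATE TRANSPORT along lattice lines: plaquettes `ε`-close to `1` propagate link values with linearly accumulating errors
# (lane A of S-BASE, crux `TwistedTraceScaling` stmt-QuantumFields-20203; first layer of the comb-gauge propagation behind `ValleyLinkProxAt`, design note
# `pub/ym-fleet/ym-luscher-20007-p1/COARSE-DESIGN.md` §16)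

The Łojasiewicz half of the valley geometry («`S(U) ≤ s` ⇒ every link of the comb-gauge representative `treeFix U` is `O(L²√s + L s^{1/4})`-close to a FLAT comb
configuration») is an induction along the comb: a plaquette whose two transverse links are (close to) `1` forces its two longitudinal links to be close to each other.
This file provides the generic, index-light layer:
* `frobNorm_hol_sub_one_le` — every plaquette holonomy satisfies `‖hol_p(V) − 1‖_F ≤ √(2·S(V))` (`‖hol − 1‖² = 4(1 − u₀(hol)) = 2·S_p`);
* ★ `frobNorm_transport_le` / `frobNorm_transport_le'` — ONE STEP: `‖V(x+eⱼ,i) − V(x,i)‖_F ≤ ‖hol(x;i,j) − 1‖_F + ‖V(x,j) − 1‖_F + ‖V(x+eᵢ,j) − 1‖_F` (longitudinal `i`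
  transported along `j`), and the mirror statement transporting `j`-links along `i` with the same plaquette;
* ★★ `frobNorm_line_sub_le` — `n` STEPS: if along the segment `x, x+eⱼ, …, x+(n−1)eⱼ` the transverse `j`-links at `y` and `y+eᵢ` are within `a` of `1` and the plaquettes
  within `ε` of `1`, then `‖V(x+n·eⱼ, i) − V(x, i)‖_F ≤ n·(ε + 2a)`;
* `lineSite x j m = x + m·eⱼ`, `lineSite_shift`, `fd_telescope` bookkeeping.
With `treeFix_eq_one_of_treeEdge` (`…TreeGauge`: tree links ARE `1`, so `a = 0` on the comb) the successor file turns these into: non-wrap links of `treeFix U` within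
`2(L−1)√(2S)` of `1`, wrap links within `O(L²√S)` of three almost-commuting constants — then `…AlmostCommutingSU2`.
HONEST FRAMING: group-valued bookkeeping for a stub lane of a child of the CONDITIONAL reduction route (femto rung R2b1); not a gap, not Clay.
-/

set_option autoImplicit false

noncomputable section

open Matrix Real
open scoped Matrix BigOperators
open Literature.MathematicalPhysics.QuantumFieldTheory
open Literature.MathematicalPhysics.QuantumLattice

namespace Summit.QuantumFields.YangMills.Theorems.FemtoTransferGap.TwoLattice.Flat

open Summit.QuantumFields.YangMills.Theorems.FemtoTransferGap
open Summit.QuantumFields.YangMills.Theorems.FemtoTransferGap.TwoLattice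
open Summit.QuantumFields.YangMills.Theorems.FemtoTransferGap.TwoLattice.Cov

variable {L : ℕ} [NeZero L]

/-- Frobenius distance on `SU(2)` (notation-free helper): `d V W = ‖V − W‖_F`. [folklore] -/
def fd (V W : SU2) : ℝ := frobNorm (((V : SU2) : Matrix (Fin 2) (Fin 2) ℂ) - ((W : SU2) : Matrix (Fin 2) (Fin 2) ℂ))

omit [NeZero L] in
/-- `d` is symmetric. [folklore] -/
theorem fd_comm (V W : SU2) : fd V W = fd W V := by
  unfold fd; rw [← frobNorm_neg]; congr 1; abel

omit [NeZero L] in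
/-- `d` is a pseudo-metric: triangle inequality. [folklore] -/
theorem fd_triangle (V W X : SU2) : fd V X ≤ fd V W + fd W X := by
  unfold fd
  have h : ((V : SU2) : Matrix (Fin 2) (Fin 2) ℂ) - ((X : SU2) : Matrix (Fin 2) (Fin 2) ℂ) =
      (((V : SU2) : Matrix (Fin 2) (Fin 2) ℂ) - ((W : SU2) : Matrix (Fin 2) (Fin 2) ℂ)) +
        (((W : SU2) : Matrix (Fin 2) (Fin 2) ℂ) - ((X : SU2) : Matrix (Fin 2) (Fin 2) ℂ)) := by abel
  rw [h]; exact frobNorm_add_le' _ _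

omit [NeZero L] in
/-- Left and right translation invariance: `d(AV, AW) = d(V, W) = d(VA, WA)`. [folklore] -/
theorem fd_mul_left (A V W : SU2) : fd (A * V) (A * W) = fd V W := by
  unfold fd; rw [Submonoid.coe_mul, Submonoid.coe_mul, ← Matrix.mul_sub, frobNorm_unitary_mul (su2_mem_unitaryGroup _)]

omit [NeZero L] in
/-- Right translation invariance. [folklore] -/
theorem fd_mul_right (A V W : SU2) : fd (V * A) (W * A) = fd V W := by
  unfold fd; rw [Submonoid.coe_mul, Submonoid.coe_mul, ← Matrix.sub_mul, frobNorm_mul_unitary _ (su2_mem_unitaryGroup _)]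

omit [NeZero L] in
/-- `d(V, 1)` in terms of the matrix: `‖V − 1‖_F`. [folklore] -/
theorem fd_one (V : SU2) : fd V 1 = frobNorm (((V : SU2) : Matrix (Fin 2) (Fin 2) ℂ) - 1) := by
  unfold fd; rw [OneMemClass.coe_one]

/-! ## §1 Plaquettes are uniformly close to `1` when the action is small -/

/-- ★ `‖hol_p(V) − 1‖_F ≤ √(2·S(V))` for every plaquette. [cite: Luscher1983, §2] -/
theorem frobNorm_hol_sub_one_le (V : GaugeConfig 3 L SU2) (p : Plaquette 3 L) :
    frobNorm (((hol V p : SU2) : Matrix (Fin 2) (Fin 2) ℂ) - 1) ≤ Real.sqrt (2 * wilsonAction su2Rep V) := by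
  have hsq : frobNorm (((hol V p : SU2) : Matrix (Fin 2) (Fin 2) ℂ) - 1) ^ 2 ≤ 2 * wilsonAction su2Rep V := by
    rw [frobNorm_sub_one_sq_eq_scalarPart, wilsonAction_eq_sum_scalarPart]
    have hle : 2 * (1 - scalarPart (hol V p)) ≤ ∑ q : Plaquette 3 L, 2 * (1 - scalarPart (hol V q)) :=
      Finset.single_le_sum (f := fun q => 2 * (1 - scalarPart (hol V q))) (fun q _ => by
        have h := scalarPart_sq_add (hol V q)
        have h2 : 0 ≤ ∑ a, vecPart (hol V q) a ^ 2 := Finset.sum_nonneg fun a _ => sq_nonneg _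
        nlinarith) (Finset.mem_univ p)
    linarith
  rw [← Real.sqrt_sq (frobNorm_nonneg _)]
  exact Real.sqrt_le_sqrt hsq

/-! ## §2 One step of approximate transport -/

omit [NeZero L] in
/-- ★ **Transport of `i`-links along `j`**: `‖V(x+eⱼ,i) − V(x,i)‖ ≤ ‖hol(x;i,j) − 1‖ + ‖V(x,j) − 1‖ + ‖V(x+eᵢ,j) − 1‖`. [cite: Luscher1983, §2] -/
theorem frobNorm_transport_le (V : GaugeConfig 3 L SU2) (x : Site 3 L) (i j : Fin 3) :
    fd (V (x.shift j, i)) (V (x, i)) ≤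
      frobNorm (((plaquetteHolonomy V x i j : SU2) : Matrix (Fin 2) (Fin 2) ℂ) - 1) + fd (V (x, j)) 1 + fd (V (x.shift i, j)) 1 := by
  set A := V (x, i); set T₁ := V (x.shift i, j); set B := V (x.shift j, i); set T₀ := V (x, j)
  have hhol : plaquetteHolonomy V x i j = A * T₁ * B⁻¹ * T₀⁻¹ := rfl
  -- `‖B − A‖ ≤ ‖B − T₀B‖ + ‖T₀B − AT₁‖ + ‖AT₁ − A‖`
  have h1 : fd B (T₀ * B) = fd T₀ 1 := by
    rw [fd_comm, show fd (T₀ * B) B = fd (T₀ * B) (1 * B) by rw [one_mul], fd_mul_right]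
  have h2 : fd (T₀ * B) (A * T₁) = frobNorm (((plaquetteHolonomy V x i j : SU2) : Matrix (Fin 2) (Fin 2) ℂ) - 1) := by
    rw [hhol, fd_comm, ← fd_one]
    have e : A * T₁ = (A * T₁ * B⁻¹ * T₀⁻¹) * (T₀ * B) := by group
    rw [show fd (A * T₁) (T₀ * B) = fd ((A * T₁ * B⁻¹ * T₀⁻¹) * (T₀ * B)) (1 * (T₀ * B)) by rw [← e, one_mul], fd_mul_right]
  have h3 : fd (A * T₁) A = fd T₁ 1 := by
    rw [show fd (A * T₁) A = fd (A * T₁) (A * 1) by rw [mul_one], fd_mul_left]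
  calc fd B A ≤ fd B (T₀ * B) + fd (T₀ * B) A := fd_triangle B (T₀ * B) A
    _ ≤ fd B (T₀ * B) + (fd (T₀ * B) (A * T₁) + fd (A * T₁) A) := add_le_add le_rfl (fd_triangle (T₀ * B) (A * T₁) A)
    _ = _ := by rw [h1, h2, h3]; ring

omit [NeZero L] in
/-- ★ **Transport of `j`-links along `i`** (same plaquette): `‖V(x+eᵢ,j) − V(x,j)‖ ≤ ‖hol(x;i,j) − 1‖ + ‖V(x,i) − 1‖ + ‖V(x+eⱼ,i) − 1‖`. [cite: Luscher1983, §2] -/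
theorem frobNorm_transport_le' (V : GaugeConfig 3 L SU2) (x : Site 3 L) (i j : Fin 3) :
    fd (V (x.shift i, j)) (V (x, j)) ≤
      frobNorm (((plaquetteHolonomy V x i j : SU2) : Matrix (Fin 2) (Fin 2) ℂ) - 1) + fd (V (x, i)) 1 + fd (V (x.shift j, i)) 1 := by
  set T₀ := V (x, i); set B := V (x.shift i, j); set T₁ := V (x.shift j, i); set A := V (x, j)
  have hhol : plaquetteHolonomy V x i j = T₀ * B * T₁⁻¹ * A⁻¹ := rfl
  have h1 : fd B (T₀ * B) = fd T₀ 1 := by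
    rw [fd_comm, show fd (T₀ * B) B = fd (T₀ * B) (1 * B) by rw [one_mul], fd_mul_right]
  have h2 : fd (T₀ * B) (A * T₁) = frobNorm (((plaquetteHolonomy V x i j : SU2) : Matrix (Fin 2) (Fin 2) ℂ) - 1) := by
    rw [hhol, ← fd_one]
    have e : T₀ * B = (T₀ * B * T₁⁻¹ * A⁻¹) * (A * T₁) := by group
    rw [show fd (T₀ * B) (A * T₁) = fd ((T₀ * B * T₁⁻¹ * A⁻¹) * (A * T₁)) (1 * (A * T₁)) by rw [← e, one_mul], fd_mul_right]
  have h3 : fd (A * T₁) A = fd T₁ 1 := by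
    rw [show fd (A * T₁) A = fd (A * T₁) (A * 1) by rw [mul_one], fd_mul_left]
  calc fd B A ≤ fd B (T₀ * B) + fd (T₀ * B) A := fd_triangle B (T₀ * B) A
    _ ≤ fd B (T₀ * B) + (fd (T₀ * B) (A * T₁) + fd (A * T₁) A) := add_le_add le_rfl (fd_triangle (T₀ * B) (A * T₁) A)
    _ = _ := by rw [h1, h2, h3]; ring

/-! ## §3 `n` steps along a line -/

/-- The `m`-th site of the line from `x` in direction `j`: `x + m·eⱼ`. [folklore] -/
def lineSite (x : Site 3 L) (j : Fin 3) (m : ℕ) : Site 3 L := x + Pi.single j ((m : ℕ) : ZMod L)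

omit [NeZero L] in
/-- `lineSite x j 0 = x`. [folklore] -/
theorem lineSite_zero (x : Site 3 L) (j : Fin 3) : lineSite x j 0 = x := by
  unfold lineSite; simp

omit [NeZero L] in
/-- `(x + m·eⱼ).shift j = x + (m+1)·eⱼ`. [folklore] -/
theorem lineSite_shift (x : Site 3 L) (j : Fin 3) (m : ℕ) : (lineSite x j m).shift j = lineSite x j (m + 1) := by
  unfold lineSite
  rw [Site.shift, add_assoc, ← Pi.single_add]; push_cast; rfl

omit [NeZero L] in
/-- Telescoping along a chain: consecutive distances `≤ c` give `fd (f n) (f 0) ≤ n·c`. [folklore] -/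
theorem fd_telescope (f : ℕ → SU2) {c : ℝ} (n : ℕ) (h : ∀ m : ℕ, m < n → fd (f (m + 1)) (f m) ≤ c) : fd (f n) (f 0) ≤ n * c := by
  induction n with
  | zero => simp only [Nat.cast_zero, zero_mul]; unfold fd; rw [sub_self, frobNorm_zero]
  | succ n ih =>
    have hih := ih fun m hm => h m (Nat.lt_succ_of_lt hm)
    have hn := h n (Nat.lt_succ_self n)
    calc fd (f (n + 1)) (f 0) ≤ fd (f (n + 1)) (f n) + fd (f n) (f 0) := fd_triangle (f (n + 1)) (f n) (f 0)
      _ ≤ c + n * c := add_le_add hn hih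
      _ = ((n + 1 : ℕ) : ℝ) * c := by push_cast; ring

omit [NeZero L] in
/-- ★★ **`n`-step approximate transport**: if for every `m < n` the plaquette at `x + m·eⱼ` (directions `i, j`) is within `ε` of `1` and its two transverse `j`-links are
within `a` of `1`, then `‖V(x + n·eⱼ, i) − V(x, i)‖_F ≤ n·(ε + 2a)`. [cite: Luscher1983, §2] -/
theorem frobNorm_line_sub_le (V : GaugeConfig 3 L SU2) (x : Site 3 L) (i j : Fin 3) {ε a : ℝ} (n : ℕ)
    (hhol : ∀ m : ℕ, m < n → frobNorm (((plaquetteHolonomy V (lineSite x j m) i j : SU2) : Matrix (Fin 2) (Fin 2) ℂ) - 1) ≤ ε)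
    (htr : ∀ m : ℕ, m < n → fd (V (lineSite x j m, j)) 1 ≤ a ∧ fd (V ((lineSite x j m).shift i, j)) 1 ≤ a) :
    fd (V (lineSite x j n, i)) (V (x, i)) ≤ n * (ε + 2 * a) := by
  have key : ∀ m : ℕ, m < n → fd (V (lineSite x j (m + 1), i)) (V (lineSite x j m, i)) ≤ ε + 2 * a := fun m hm => by
    have hstep := frobNorm_transport_le V (lineSite x j m) i j
    rw [lineSite_shift] at hstep
    obtain ⟨h1, h2⟩ := htr m hm
    linarith [hhol m hm]
  have h := fd_telescope (fun m => V (lineSite x j m, i)) n key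
  rw [lineSite_zero] at h
  exact h

omit [NeZero L] in
/-- ★★ **`n`-step transport of `j`-links along `i`** (mirror of `frobNorm_line_sub_le`). [cite: Luscher1983, §2] -/
theorem frobNorm_line_sub_le' (V : GaugeConfig 3 L SU2) (x : Site 3 L) (i j : Fin 3) {ε a : ℝ} (n : ℕ)
    (hhol : ∀ m : ℕ, m < n → frobNorm (((plaquetteHolonomy V (lineSite x i m) i j : SU2) : Matrix (Fin 2) (Fin 2) ℂ) - 1) ≤ ε)
    (htr : ∀ m : ℕ, m < n → fd (V (lineSite x i m, i)) 1 ≤ a ∧ fd (V ((lineSite x i m).shift j, i)) 1 ≤ a) :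
    fd (V (lineSite x i n, j)) (V (x, j)) ≤ n * (ε + 2 * a) := by
  have key : ∀ m : ℕ, m < n → fd (V (lineSite x i (m + 1), j)) (V (lineSite x i m, j)) ≤ ε + 2 * a := fun m hm => by
    have hstep := frobNorm_transport_le' V (lineSite x i m) i j
    rw [lineSite_shift] at hstep
    obtain ⟨h1, h2⟩ := htr m hm
    linarith [hhol m hm]
  have h := fd_telescope (fun m => V (lineSite x i m, j)) n key
  rw [lineSite_zero] at h
  exact h

/-! ## §4 The comb gauge: tree links are exactly `1`, plaquettes are uniformly small -/

/-- In the comb gauge the transverse hypotheses hold with `a = 0` on tree links: `fd (treeFix U e) 1 = 0`. [cite: SeilerLNP1982, §2] -/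
theorem fd_treeFix_one_of_treeEdge (U : GaugeConfig 3 L SU2) {e : Edge 3 L} (he : treeEdge e = true) : fd (treeFix U e) 1 = 0 := by
  rw [treeFix_eq_one_of_treeEdge U he]; unfold fd; rw [sub_self, frobNorm_zero]

/-- The comb gauge has the same action, hence the same uniform plaquette bound `√(2S(U))`. [folklore] -/
theorem frobNorm_hol_treeFix_sub_one_le (U : GaugeConfig 3 L SU2) (x : Site 3 L) (ij : {q : Fin 3 × Fin 3 // q.1 < q.2}) :
    frobNorm (((plaquetteHolonomy (treeFix U) x ij.1.1 ij.1.2 : SU2) : Matrix (Fin 2) (Fin 2) ℂ) - 1) ≤ Real.sqrt (2 * wilsonAction su2Rep U) := by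
  have h := frobNorm_hol_sub_one_le (treeFix U) (x, ij)
  simp only [hol] at h
  unfold treeFix at h ⊢
  rwa [wilsonAction_gaugeTransform] at h

end Summit.QuantumFields.YangMills.Theorems.FemtoTransferGap.TwoLattice.Flat

end
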